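import Literature.NumberTheory.EllipticCurves.Monsky1990.TwoAdicSquareClasses
import HarnessLib

/-!
# Monsky 1990, Lemma 5.4 — the "eight cases": the arithmetic core

Monsky, *Mock Heegner points and congruent numbers*, Math. Z. 204 (1990), p. 62, proof of Lemma 5.4
(`D = p₃p₅`): after the Galois bookkeeping one has a rational `0 < u < 1` with

  `u = p₅·(square)` or `2p₅·(square)`, `u + 1 = p₃·(square)` or `2p₃·(square)`,
  `u − 1 = −(square)` or `−2·(square)`,

"So eight cases arise. But they are all impossible. For in the two cases in which `u = 2p₅ (square)`
while `u − 1 = −2 (square)` the quadratic form `r² + p₅s²` would have to represent `2` rationally. And in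
each of the other cases, `u` is `2`-integral, and a congruence argument modulo a power of `2` gives a
contradiction. (Suppose for example that `u = p₅ (square)`, `u + 1 = 2p₃ (square)` and
`u − 1 = −(square)`. Then `u + 1 ≡ 0, 6` or `8 (16)` while `u − 1 ≡ 0` or `12 (16)`.)"

This file proves that statement in full (`no_solution_of_square_classes`), for primes `p ≡ 5 (mod 8)`
and `q ≡ 3 (mod 8)` (Monsky's `p₅`, `p₃`), uniformly in the eight cases `(a₁, a₂, a₃) ∈ {0, 1}³`:

* if `ord₂ u ≥ 0`, then `u`, `u + 1`, `1 − u` and the square roots are `2`-integral, and reducing modulo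
  `16` (`TwoAdicSquareClasses.red`) leaves a finite check (`check_integral`, decided by `decide`) — this
  covers all eight cases, including the two "`r² + p₅s² = 2`" cases (Monsky's Hilbert-symbol argument is
  kept in `TwoAdicSquareClasses.eq_zero_of_sq_add_mul_sq_eq_two_mul_sq` but is not needed here);
* if `ord₂ u < 0`, then `ord₂ u = ord₂(u + 1) = ord₂(1 − u) = −k`, the three exponents agree, and after
  multiplying by `2ᵏ` the three square roots become `2`-adic units, whose squares are `≡ 1, 9 (mod 16)`;
  a second finite check (`check_scaled`) gives the contradiction.

Everything is fully proved; no named facts.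

## References

* P. Monsky, Mock Heegner points and congruent numbers, Math. Z. 204 (1990) 45–67, Lemma 5.4 (p. 62).
  [Monsky1990MockHeegner]
-/

noncomputable section

namespace Literature.NumberTheory.EllipticCurves.Monsky1990

/-! ### Finite checks modulo `16` -/

/-- The squares modulo `16` are `0, 1, 4, 9`. [cite: Monsky1990MockHeegner, Lemma 5.4 (p. 62), the congruence argument modulo a power of 2] -/
theorem sq_zmod16 (t : ZMod 16) : t ^ 2 = 0 ∨ t ^ 2 = 1 ∨ t ^ 2 = 4 ∨ t ^ 2 = 9 := by
  revert t
  decide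

/-- The square of an odd residue modulo `16` is `1` or `9`. [cite: Monsky1990MockHeegner, Lemma 5.4 (p. 62), the congruence argument modulo a power of 2] -/
theorem sq_zmod16_of_odd (t : ZMod 16) (ht : ∃ k : ZMod 16, t = 2 * k + 1) :
    t ^ 2 = 1 ∨ t ^ 2 = 9 := by
  obtain ⟨k, rfl⟩ := ht
  revert k
  decide

/-- A residue `t` with `t · (odd) = odd` is odd. [cite: Monsky1990MockHeegner, Lemma 5.4 (p. 62), the congruence argument modulo a power of 2] -/
theorem exists_eq_two_mul_add_one_of_mul (t d m : ZMod 16) (h : t * (2 * d + 1) = 2 * m + 1) :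
    ∃ k : ZMod 16, t = 2 * k + 1 := by
  revert t d m
  decide

/-- Powers of `2` modulo `16` with positive exponent are `2, 4, 8` or `0`. [cite: Monsky1990MockHeegner, Lemma 5.4 (p. 62), the congruence argument modulo a power of 2] -/
theorem two_pow_zmod16 (k : ℕ) (hk : 1 ≤ k) :
    (2 : ZMod 16) ^ k = 2 ∨ (2 : ZMod 16) ^ k = 4 ∨ (2 : ZMod 16) ^ k = 8 ∨ (2 : ZMod 16) ^ k = 0 := by
  rcases k with _ | _ | _ | _ | k
  · omega
  · left; rfl
  · right; left; rfl
  · right; right; left; rfl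
  · right; right; right
    rw [show k + 1 + 1 + 1 + 1 = k + 4 by ring, pow_add]
    have : (2 : ZMod 16) ^ 4 = 0 := rfl
    rw [this, mul_zero]

/-- **The eight cases, `2`-integral branch** (Monsky: "a congruence argument modulo a power of `2`"): no
residues `ū, s₁, s₂, s₃ ∈ ℤ/16` with `s_i` squares satisfy `ū = 2^{a₁} p s₁`, `ū + 1 = 2^{a₂} q s₂`,
`1 − ū = 2^{a₃} s₃` for `p ≡ 5, q ≡ 3 (mod 8)` and `a_i ∈ {0, 1}` — a finite check.
[cite: Monsky1990MockHeegner, Lemma 5.4 (p. 62)] -/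
theorem check_integral (a₁ a₂ a₃ : ℕ) (ha₁ : a₁ ≤ 1) (ha₂ : a₂ ≤ 1) (ha₃ : a₃ ≤ 1) (pm qm : ZMod 16)
    (hpm : pm = 5 ∨ pm = 13) (hqm : qm = 3 ∨ qm = 11) (s₁ s₂ s₃ : ZMod 16)
    (hs₁ : s₁ = 0 ∨ s₁ = 1 ∨ s₁ = 4 ∨ s₁ = 9) (hs₂ : s₂ = 0 ∨ s₂ = 1 ∨ s₂ = 4 ∨ s₂ = 9)
    (hs₃ : s₃ = 0 ∨ s₃ = 1 ∨ s₃ = 4 ∨ s₃ = 9)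
    (h2 : 2 ^ a₁ * pm * s₁ + 1 = 2 ^ a₂ * qm * s₂) (h3 : 1 - 2 ^ a₁ * pm * s₁ = 2 ^ a₃ * s₃) :
    False := by
  rcases Nat.le_one_iff_eq_zero_or_eq_one.mp ha₁ with rfl | rfl <;>
  rcases Nat.le_one_iff_eq_zero_or_eq_one.mp ha₂ with rfl | rfl <;>
  rcases Nat.le_one_iff_eq_zero_or_eq_one.mp ha₃ with rfl | rfl <;>
  rcases hpm with rfl | rfl <;> rcases hqm with rfl | rfl <;>
  rcases hs₁ with rfl | rfl | rfl | rfl <;> rcases hs₂ with rfl | rfl | rfl | rfl <;>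
  rcases hs₃ with rfl | rfl | rfl | rfl <;> revert h2 h3 <;> decide

/-- **The eight cases, non-integral branch**: after scaling by `2ᵏ` (`k ≥ 1`) the square roots are
`2`-adic units; no residues `ū, f, s₁, s₂, s₃ ∈ ℤ/16` with `f = 2ᵏ`, `s_i ∈ {1, 9}` satisfy
`ū = p s₁`, `ū + f = q s₂`, `f − ū = s₃` — a finite check.
[cite: Monsky1990MockHeegner, Lemma 5.4 (p. 62)] -/
theorem check_scaled (f pm qm s₁ s₂ s₃ : ZMod 16) (hf : f = 2 ∨ f = 4 ∨ f = 8 ∨ f = 0)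
    (hpm : pm = 5 ∨ pm = 13) (hqm : qm = 3 ∨ qm = 11) (hs₁ : s₁ = 1 ∨ s₁ = 9)
    (hs₂ : s₂ = 1 ∨ s₂ = 9) (hs₃ : s₃ = 1 ∨ s₃ = 9) (h2 : pm * s₁ + f = qm * s₂)
    (h3 : f - pm * s₁ = s₃) : False := by
  rcases hf with rfl | rfl | rfl | rfl <;> rcases hpm with rfl | rfl <;> rcases hqm with rfl | rfl <;>
  rcases hs₁ with rfl | rfl <;> rcases hs₂ with rfl | rfl <;> rcases hs₃ with rfl | rfl <;>
  revert h2 h3 <;> decide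

/-! ### `2`-adic valuations of the square-class relations -/

/-- `ord₂(2^a · c · r²) = a + 2 ord₂ r` for `c` odd and `r ≠ 0`. [cite: Monsky1990MockHeegner, Lemma 5.4 (p. 62), the congruence argument modulo a power of 2] -/
theorem padicValRat_two_of_eq {c : ℕ} (hc : c % 2 = 1) {a : ℕ} {u r : ℚ} (hr : r ≠ 0)
    (h : u = 2 ^ a * c * r ^ 2) : padicValRat 2 u = a + 2 * padicValRat 2 r := by
  have hc0 : (c : ℚ) ≠ 0 := by
    have : c ≠ 0 := by omega
    exact_mod_cast this
  have hc2 : ¬ 2 ∣ c := by omega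
  have h2 : (2 : ℚ) ^ a ≠ 0 := pow_ne_zero a two_ne_zero
  rw [h, padicValRat.mul (mul_ne_zero h2 hc0) (pow_ne_zero 2 hr), padicValRat.mul h2 hc0,
    padicValRat.pow, padicValRat.pow,
    show (2 : ℚ) = ((2 : ℕ) : ℚ) by norm_num, padicValRat.of_nat, padicValRat.of_nat,
    padicValNat_self, padicValNat.eq_zero_of_not_dvd hc2]
  push_cast
  ring

/-- **The square of the reduction of a `2`-adic unit is `1` or `9` modulo `16`**: a non-zero rational
`x` with `ord₂ x = 0` has odd numerator and denominator, so `red x · den = num` is odd. [cite: Monsky1990MockHeegner, Lemma 5.4 (p. 62), the congruence argument modulo a power of 2] -/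
theorem red_sq_eq_one_or_nine {x : ℚ} (hx0 : x ≠ 0) (hx : ¬ 2 ∣ x.den) (h : padicValRat 2 x = 0) :
    red 4 x hx ^ 2 = 1 ∨ red 4 x hx ^ 2 = 9 := by
  -- the numerator is odd
  have hnum : ¬ (2 : ℤ) ∣ x.num := by
    intro hn
    have hv : padicValRat 2 x = padicValInt 2 x.num - padicValNat 2 x.den := rfl
    rw [padicValNat.eq_zero_of_not_dvd hx] at hv
    have h1 : ((2 : ℕ) : ℤ) ^ 1 ∣ x.num := by simpa using hn
    rw [padicValInt_dvd_iff] at h1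
    rcases h1 with h1 | h1
    · exact Rat.num_ne_zero.mpr hx0 h1
    · omega
  -- `x · den = num` reduced modulo `16`
  have hnd : x * (x.den : ℚ) = (x.num : ℚ) := Rat.mul_den_eq_num x
  have hred := red_congr 4 (not_two_dvd_den_mul hx (not_two_dvd_den_natCast _))
    (not_two_dvd_den_intCast x.num) hnd
  rw [red_mul 4 hx (not_two_dvd_den_natCast _), red_natCast, red_intCast] at hred
  -- odd integers reduce to odd residues
  obtain ⟨d', hd'⟩ : ∃ d' : ℕ, x.den = 2 * d' + 1 := by
    obtain ⟨d', hd'⟩ := Nat.odd_iff.mpr (Nat.two_dvd_ne_zero.mp hx)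
    exact ⟨d', hd'⟩
  obtain ⟨m', hm'⟩ : ∃ m' : ℤ, x.num = 2 * m' + 1 := by
    obtain ⟨m', hm'⟩ := Int.odd_iff.mpr (Int.two_dvd_ne_zero.mp hnum)
    exact ⟨m', hm'⟩
  rw [hd', hm'] at hred
  push_cast at hred
  exact sq_zmod16_of_odd _ (exists_eq_two_mul_add_one_of_mul _ _ _ hred)

/-- `ord₂` of `2^k · x` for `x ≠ 0`. [cite: Monsky1990MockHeegner, Lemma 5.4 (p. 62), the congruence argument modulo a power of 2] -/
theorem padicValRat_two_pow_mul (k : ℕ) {x : ℚ} (hx : x ≠ 0) :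
    padicValRat 2 (2 ^ k * x) = k + padicValRat 2 x := by
  rw [padicValRat.mul (pow_ne_zero k two_ne_zero) hx, padicValRat.pow,
    show (2 : ℚ) = ((2 : ℕ) : ℚ) by norm_num, padicValRat.of_nat, padicValNat_self]
  push_cast
  ring

/-! ### The theorem -/

/-- Reduction of `p ≡ 5 (mod 8)` modulo `16`. [cite: Monsky1990MockHeegner, Lemma 5.4 (p. 62), the congruence argument modulo a power of 2] -/
theorem natCast_zmod16_of_mod_eight_five {p : ℕ} (hp : p % 8 = 5) :
    (p : ZMod 16) = 5 ∨ (p : ZMod 16) = 13 := by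
  rw [← ZMod.natCast_mod p 16]
  have : p % 16 = 5 ∨ p % 16 = 13 := by omega
  rcases this with h | h <;> rw [h]
  · left; rfl
  · right; rfl

/-- Reduction of `q ≡ 3 (mod 8)` modulo `16`. [cite: Monsky1990MockHeegner, Lemma 5.4 (p. 62), the congruence argument modulo a power of 2] -/
theorem natCast_zmod16_of_mod_eight_three {q : ℕ} (hq : q % 8 = 3) :
    (q : ZMod 16) = 3 ∨ (q : ZMod 16) = 11 := by
  rw [← ZMod.natCast_mod q 16]
  have : q % 16 = 3 ∨ q % 16 = 11 := by omega
  rcases this with h | h <;> rw [h]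
  · left; rfl
  · right; rfl

/-- **Monsky 1990, Lemma 5.4, the eight cases**: for primes `p ≡ 5 (mod 8)` and `q ≡ 3 (mod 8)` there is
no rational `0 < u < 1` with `u = 2^{a₁} p r₁²`, `u + 1 = 2^{a₂} q r₂²`, `1 − u = 2^{a₃} r₃²`
(`a_i ∈ {0, 1}`, `r_i ∈ ℚ`). Monsky: "So eight cases arise. But they are all impossible."
Proof: if `ord₂ u ≥ 0` reduce everything modulo `16` (`check_integral`); if `ord₂ u = −k < 0` the three
exponents agree and, after multiplying by `2ᵏ`, the square roots are `2`-adic units (`check_scaled`).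
[cite: Monsky1990MockHeegner, Lemma 5.4 (p. 62)] -/
theorem no_solution_of_square_classes {p q : ℕ} (hp8 : p % 8 = 5) (hq8 : q % 8 = 3) {u r₁ r₂ r₃ : ℚ}
    (hu0 : 0 < u) (hu1 : u < 1) {a₁ a₂ a₃ : ℕ} (ha₁ : a₁ ≤ 1) (ha₂ : a₂ ≤ 1) (ha₃ : a₃ ≤ 1)
    (h1 : u = 2 ^ a₁ * p * r₁ ^ 2) (h2 : u + 1 = 2 ^ a₂ * q * r₂ ^ 2)
    (h3 : 1 - u = 2 ^ a₃ * r₃ ^ 2) : False := by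
  have hp2 : p % 2 = 1 := by omega
  have hq2 : q % 2 = 1 := by omega
  have hpm := natCast_zmod16_of_mod_eight_five hp8
  have hqm := natCast_zmod16_of_mod_eight_three hq8
  have h3' : 1 - u = 2 ^ a₃ * ((1 : ℕ) : ℚ) * r₃ ^ 2 := by rw [h3]; push_cast; ring
  -- the square roots are non-zero
  have hr₁ : r₁ ≠ 0 := by
    rintro rfl
    rw [h1] at hu0
    simp at hu0
  have hr₂ : r₂ ≠ 0 := by
    rintro rfl
    rw [zero_pow two_ne_zero, mul_zero] at h2
    linarith
  have hr₃ : r₃ ≠ 0 := by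
    rintro rfl
    rw [zero_pow two_ne_zero, mul_zero] at h3
    linarith
  -- the valuations
  have hv₁ := padicValRat_two_of_eq hp2 hr₁ h1
  have hv₂ := padicValRat_two_of_eq hq2 hr₂ h2
  have hv₃ := padicValRat_two_of_eq (by norm_num) hr₃ h3'
  have hu : u ≠ 0 := hu0.ne'
  have hu1' : u + 1 ≠ 0 := by linarith
  have hu1'' : 1 - u ≠ 0 := by linarith
  rcases le_or_gt 0 (padicValRat 2 u) with hpos | hneg
  · -- `2`-integral branch
    have hvu1 : 0 ≤ padicValRat 2 (u + 1) := by
      have := padicValRat.min_le_padicValRat_add (p := 2) hu1'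
      rw [padicValRat.one] at this
      omega
    have hvu2 : 0 ≤ padicValRat 2 (1 - u) := by
      have := padicValRat.min_le_padicValRat_add (p := 2) (q := 1) (r := -u) (by rwa [← sub_eq_add_neg])
      rw [padicValRat.one, padicValRat.neg, ← sub_eq_add_neg] at this
      omega
    have hvr₁ : 0 ≤ padicValRat 2 r₁ := by omega
    have hvr₂ : 0 ≤ padicValRat 2 r₂ := by omega
    have hvr₃ : 0 ≤ padicValRat 2 r₃ := by omega
    have hdu := not_two_dvd_den_of_padicValRat_nonneg hpos
    have hdu1 := not_two_dvd_den_of_padicValRat_nonneg hvu1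
    have hdu2 := not_two_dvd_den_of_padicValRat_nonneg hvu2
    have hdr₁ := not_two_dvd_den_of_padicValRat_nonneg hvr₁
    have hdr₂ := not_two_dvd_den_of_padicValRat_nonneg hvr₂
    have hdr₃ := not_two_dvd_den_of_padicValRat_nonneg hvr₃
    -- reduce the three relations modulo `16`
    have e1 := red_of_eq_two_pow_mul_natCast_mul_sq 4 a₁ p hdu hdr₁ h1
    have e2 := red_of_eq_two_pow_mul_natCast_mul_sq 4 a₂ q hdu1 hdr₂ h2
    have e3 := red_of_eq_two_pow_mul_natCast_mul_sq 4 a₃ 1 hdu2 hdr₃ h3'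
    have hd1 : ¬ 2 ∣ (1 : ℚ).den := by norm_num
    rw [red_add 4 hdu hd1 hdu1, red_one, e1] at e2
    rw [red_sub 4 hd1 hdu hdu2, red_one, e1] at e3
    push_cast at e3
    rw [mul_one] at e3
    exact check_integral a₁ a₂ a₃ ha₁ ha₂ ha₃ _ _ hpm hqm _ _ _ (sq_zmod16 _) (sq_zmod16 _)
      (sq_zmod16 _) e2 e3
  · -- non-integral branch: `ord₂ u = ord₂ (u + 1) = ord₂ (1 − u) < 0`
    have hvu1 : padicValRat 2 (u + 1) = padicValRat 2 u :=
      padicValRat.add_eq_of_lt hu1' hu one_ne_zero (by rw [padicValRat.one]; exact hneg)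
    have hvu2 : padicValRat 2 (1 - u) = padicValRat 2 u := by
      have := padicValRat.add_eq_of_lt (p := 2) (q := -u) (r := 1) (by rwa [neg_add_eq_sub])
        (neg_ne_zero.mpr hu) one_ne_zero (by rw [padicValRat.one, padicValRat.neg]; exact hneg)
      rwa [neg_add_eq_sub, padicValRat.neg] at this
    -- the three exponents agree: `a₁ = a₂ = a₃`
    have ha12 : a₂ = a₁ := by omega
    have ha13 : a₃ = a₁ := by omega
    subst a₂
    subst a₃
    -- `ord₂ r₁ = ord₂ r₂ = ord₂ r₃ = −j` with `j ≥ 1`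
    obtain ⟨j, hj⟩ : ∃ j : ℕ, padicValRat 2 r₁ = -j := by
      refine ⟨(-padicValRat 2 r₁).toNat, ?_⟩
      have : 0 ≤ -padicValRat 2 r₁ := by omega
      omega
    have hj1 : 1 ≤ j := by omega
    have hvr₂ : padicValRat 2 r₂ = -j := by omega
    have hvr₃ : padicValRat 2 r₃ = -j := by omega
    -- scale by `2ᵏ`, `k = 2j − a₁ ≥ 1`
    obtain ⟨k, hk1, hkj⟩ : ∃ k : ℕ, 1 ≤ k ∧ k + a₁ = 2 * j := ⟨2 * j - a₁, by omega, by omega⟩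
    set t₁ : ℚ := 2 ^ j * r₁ with ht₁
    set t₂ : ℚ := 2 ^ j * r₂ with ht₂
    set t₃ : ℚ := 2 ^ j * r₃ with ht₃
    have ht₁0 : t₁ ≠ 0 := mul_ne_zero (pow_ne_zero j two_ne_zero) hr₁
    have ht₂0 : t₂ ≠ 0 := mul_ne_zero (pow_ne_zero j two_ne_zero) hr₂
    have ht₃0 : t₃ ≠ 0 := mul_ne_zero (pow_ne_zero j two_ne_zero) hr₃
    have hvt₁ : padicValRat 2 t₁ = 0 := by rw [ht₁, padicValRat_two_pow_mul j hr₁, hj]; ring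
    have hvt₂ : padicValRat 2 t₂ = 0 := by rw [ht₂, padicValRat_two_pow_mul j hr₂, hvr₂]; ring
    have hvt₃ : padicValRat 2 t₃ = 0 := by rw [ht₃, padicValRat_two_pow_mul j hr₃, hvr₃]; ring
    have hdt₁ : ¬ 2 ∣ t₁.den := not_two_dvd_den_of_padicValRat_nonneg (by rw [hvt₁])
    have hdt₂ : ¬ 2 ∣ t₂.den := not_two_dvd_den_of_padicValRat_nonneg (by rw [hvt₂])
    have hdt₃ : ¬ 2 ∣ t₃.den := not_two_dvd_den_of_padicValRat_nonneg (by rw [hvt₃])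
    -- the scaled relations
    have hpow : (2 : ℚ) ^ k * 2 ^ a₁ = (2 ^ j) ^ 2 := by
      rw [← pow_add, hkj, ← pow_mul, mul_comm]
    have s1 : (2 : ℚ) ^ k * u = 2 ^ 0 * p * t₁ ^ 2 := by
      rw [h1, ht₁]; linear_combination (p * r₁ ^ 2) * hpow
    have s2 : (2 : ℚ) ^ k * u + 2 ^ k = 2 ^ 0 * q * t₂ ^ 2 := by
      rw [ht₂]; linear_combination (2 : ℚ) ^ k * h2 + (q * r₂ ^ 2) * hpow
    have s3 : (2 : ℚ) ^ k - 2 ^ k * u = 2 ^ 0 * ((1 : ℕ) : ℚ) * t₃ ^ 2 := by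
      rw [ht₃]; push_cast; linear_combination (2 : ℚ) ^ k * h3 + (r₃ ^ 2) * hpow
    have hdsu : ¬ 2 ∣ ((2 : ℚ) ^ k * u).den :=
      not_two_dvd_den_of_padicValRat_nonneg (by rw [padicValRat_two_pow_mul k hu]; omega)
    have hd2k : ¬ 2 ∣ ((2 : ℚ) ^ k).den := by
      rw [show (2 : ℚ) ^ k = ((2 ^ k : ℕ) : ℚ) by push_cast; rfl]
      exact not_two_dvd_den_natCast _
    have hdsum : ¬ 2 ∣ ((2 : ℚ) ^ k * u + 2 ^ k).den := not_two_dvd_den_add hdsu hd2k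
    have hdsub : ¬ 2 ∣ ((2 : ℚ) ^ k - 2 ^ k * u).den := not_two_dvd_den_sub hd2k hdsu
    -- reduce modulo `16`
    have f1 := red_of_eq_two_pow_mul_natCast_mul_sq 4 0 p hdsu hdt₁ s1
    have f2 := red_of_eq_two_pow_mul_natCast_mul_sq 4 0 q hdsum hdt₂ s2
    have f3 := red_of_eq_two_pow_mul_natCast_mul_sq 4 0 1 hdsub hdt₃ s3
    have hf : red 4 (2 ^ k) hd2k = (2 : ZMod 16) ^ k := by
      rw [red_congr 4 hd2k (not_two_dvd_den_natCast (2 ^ k)) (by push_cast; rfl), red_natCast]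
      push_cast
      rfl
    rw [red_add 4 hdsu hd2k hdsum, hf, f1] at f2
    rw [red_sub 4 hd2k hdsu hdsub, hf, f1] at f3
    simp only [pow_zero, one_mul] at f1 f2 f3
    push_cast at f3
    simp only [one_mul] at f3
    exact check_scaled _ _ _ _ _ _ (two_pow_zmod16 k hk1) hpm hqm
      (red_sq_eq_one_or_nine ht₁0 hdt₁ hvt₁) (red_sq_eq_one_or_nine ht₂0 hdt₂ hvt₂)
      (red_sq_eq_one_or_nine ht₃0 hdt₃ hvt₃) f2 f3

end Literature.NumberTheory.EllipticCurves.Monsky1990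

end
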